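import Summits.QuantumFields.BalabanUV.T4Continuum.Support.ShellMeasureBlockWiring

/-!
# `T4Continuum.ShellMeasureBlockWiringUniform` — S4 file 2: the LEVEL-ONLY MAJORANT of END-II's slot constant from
# uniform block geometry (for the SEAM END-I ∘ END-II, row S13)
# (cell `pub-balaban`, sub-cell `t4`, spine estimate NE7c (node U5b); ROUND-2 crew seat `t4-ne7c-formalise-leaf-07`, row S4
# of `t4/b2b-balaban-t4-ne7c-p1/LEAVES-NE7c-P1.md`; answers `t4/formal/NE7c/DAG.md` T-NE7c-1 ∕ leaf-08's XREAD INFO-2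
# «the wiring needs a level-uniform majorant `D_j ≥` every slot constant at level `j` (uniform block geometry)»;
# ADDITIVE — imports `ShellMeasureBlockWiring` (S4 file 1) only; 0 def, 0 sorry, 0 citations)

HONEST FRAMING.  Finite four-torus programme, rung (B)+1 only — NOT infinite volume, NOT a mass gap, NOT the Clay
problem, NOT summit progress; (B), `BetaPertHyp`, (B^μ) not consumed.  NE7c NOT PRINTED, NOT PROVED; (M1) for Bałaban's
effective measures NOT PRINTED (GAPS G-ne7cp1-1), asserted by nobody.  BOOKKEEPING only («NE7c ⇐ the named binders»,
trigger c3): END-II's per-slot constant `2(n + β Σ_{p∈P_w} L̄_p(d̄_p + 4 s̄_p) + B_𝓔)/(1−δ)` of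
`ShellMeasureBlockWiring.slotAC_realized_su2_of_blockBondData` depends on the SLOT through the chart dimension `n = 3·#Λ`,
the weight plaquettes `P_w` and the per-plaquette sums; END-I (`ShellMeasureRootComposition.shellWeightBound_of_slotAC`)
indexes its constant by the LEVEL only.  Under UNIFORM block geometry at a level — `n ≤ n̄`, `#P_w ≤ N̄_w`, per-bond sizes
`a_b ≤ ā` and frozen deviations `d_b ≤ d̄` — the slot constant is majorised by the level-only number
`D̄ = 2(n̄ + β·N̄_w·(12ā/(Rad−1))·(4d̄ + 16ā) + B_𝓔)/(1−δ)` (four bonds per plaquette), and (M1) passes to `D̄` by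
`T4ShellMeasureFibre.slotAntiConcentration_mono`.  No `def … : Prop` (c2); nothing instantiated at any live level; the
majorant's inputs are displayed BINDERS.  HONEST DEPENDENCY (cell): continuum YM on T⁴ ⇐ BetaPertH ∧ nine spine estimates
(0/9 proved); BetaPertH ⇐ (D1) ∧ (D4) ∧ CAP+tail; G-an2-4 gates asym, D1 and NE2/3/4.

WHAT IS PROVED ([folklore]).  `movingSize_le_length_mul`, `frozenSize_le_length_mul` (list sizes `≤ length · bound`);
`plaqSizes_le` (`s̄_p ≤ 4ā`, `L̄_p ≤ 12ā/(Rad−1)`, `d̄_p ≤ 4d̄`); `slotConst_le_uniform` (the majorant inequality);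
`slotAC_realized_su2_of_blockBondData_uniform` (END-II from block bond data with the LEVEL-ONLY constant `D̄`).

WHAT THIS DOES NOT DO.  No estimate; SM-L1…L8 untouched; NE7c NOT proved; 0/9 spine.
-/

noncomputable section
open NormedSpace Set Function MeasureTheory Metric

namespace Summit.QuantumFields.BalabanUV.T4Continuum.ShellMeasureBlockWiring

open scoped ENNReal
open Literature.MathematicalPhysics.QuantumFieldTheory.Balaban1983to89
open GaugeField (GaugeInvariant)
open T4ShellMeasure (SlotAntiConcentration)
open T4ShellMeasureFibre (slotAntiConcentration_mono)
open T4CubeChartGnomonic (SU2)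
open T4CubeChartExp (expWindowDensity expFibreChart)
open T4ShellMeasureDet (blockLaw)
open T4TreeGaugeFixing (NoClosedLoop fixTo)
open ShellMeasureWilsonTrace (TraceData)
open ShellMeasureLevelAssembly (classifier weight)

/-! ## §1 Uniform bounds on the oriented-list sizes -/

section Generic

variable {𝔟 : Type*} [DecidableEq 𝔟]

/-- `Σ_{(b,o), b ∈ Λ} a b ≤ length · ā` when `a ≤ ā` on `Λ` and `0 ≤ ā`. [folklore] -/
theorem movingSize_le_length_mul (Λ : Finset 𝔟) {a : 𝔟 → ℝ} {ā : ℝ} (hā0 : 0 ≤ ā) (ha : ∀ b ∈ Λ, a b ≤ ā) :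
    ∀ obs : List (𝔟 × Bool), movingSize Λ a obs ≤ obs.length * ā
  | [] => by simp [movingSize]
  | bo :: obs => by
    have ih := movingSize_le_length_mul Λ hā0 ha obs
    simp only [movingSize] at ih
    simp only [movingSize, List.map_cons, List.sum_cons, List.length_cons, Nat.cast_succ]
    have h1 : (if bo.1 ∈ Λ then a bo.1 else 0) ≤ ā := by
      by_cases h : bo.1 ∈ Λ
      · simpa only [h, ↓reduceIte] using ha bo.1 h
      · simpa only [h, ↓reduceIte] using hā0
    linarith

/-- `Σ_{(b,o), b ∉ Λ} d b ≤ length · d̄` when `d ≤ d̄` off `Λ` and `0 ≤ d̄`. [folklore] -/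
theorem frozenSize_le_length_mul (Λ : Finset 𝔟) {d : 𝔟 → ℝ} {dbar : ℝ} (hd0 : 0 ≤ dbar) (hd : ∀ b ∉ Λ, d b ≤ dbar) :
    ∀ obs : List (𝔟 × Bool), frozenSize Λ d obs ≤ obs.length * dbar
  | [] => by simp [frozenSize]
  | bo :: obs => by
    have ih := frozenSize_le_length_mul Λ hd0 hd obs
    simp only [frozenSize] at ih
    simp only [frozenSize, List.map_cons, List.sum_cons, List.length_cons, Nat.cast_succ]
    have h1 : (if bo.1 ∈ Λ then 0 else d bo.1) ≤ dbar := by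
      by_cases h : bo.1 ∈ Λ
      · simpa only [h, ↓reduceIte] using hd0
      · simpa only [h, ↓reduceIte] using hd bo.1 h
    linarith

end Generic

/-! ## §2 The plaquette sizes and the slot constant under uniform block geometry -/

section Cell

variable {P : Params} {j : ℕ} [DecidableEq (PBond P j)]

/-- per plaquette (four oriented bonds): `s̄_p ≤ 4ā`, `L̄_p ≤ 12ā/(Rad−1)`, `d̄_p ≤ 4d̄`. [folklore] -/
theorem plaqSizes_le (Λ : Finset (PBond P j)) {a d : PBond P j → ℝ} {ā dbar Rad : ℝ} (hā0 : 0 ≤ ā)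
    (hd0 : 0 ≤ dbar) (hRad : 1 < Rad) (ha : ∀ b ∈ Λ, a b ≤ ā) (hd : ∀ b ∉ Λ, d b ≤ dbar) (p : Plaq P j) :
    movingSize Λ a (plaqOBonds p) ≤ 4 * ā ∧
      movingSize Λ (fun b => 3 * a b / (Rad - 1)) (plaqOBonds p) ≤ 12 * ā / (Rad - 1) ∧
      frozenSize Λ d (plaqOBonds p) ≤ 4 * dbar := by
  have hR1 : 0 < Rad - 1 := by linarith
  refine ⟨?_, ?_, ?_⟩
  · simpa [length_plaqOBonds] using movingSize_le_length_mul Λ hā0 ha (plaqOBonds p)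
  · have h := movingSize_le_length_mul Λ (a := fun b => 3 * a b / (Rad - 1)) (ā := 3 * ā / (Rad - 1))
      (div_nonneg (by linarith) hR1.le)
      (fun b hb => div_le_div_of_nonneg_right (by linarith [ha b hb]) hR1.le) (plaqOBonds p)
    have e : ((plaqOBonds p).length : ℝ) * (3 * ā / (Rad - 1)) = 12 * ā / (Rad - 1) := by
      rw [length_plaqOBonds]; push_cast; ring
    rwa [e] at h
  · simpa [length_plaqOBonds] using frozenSize_le_length_mul Λ hd0 hd (plaqOBonds p)

/-- **THE LEVEL-ONLY MAJORANT** of END-II's slot constant under uniform block geometry: `n ≤ n̄`, `#P_w ≤ N̄_w`,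
`a ≤ ā` on `Λ`, `d ≤ d̄` off `Λ`, `0 ≤ a, d`, `β ≥ 0`, `δ < 1`, `Rad > 1` ⇒
`2(n + β Σ_{p∈P_w} L̄_p(d̄_p + 4 s̄_p) + B_𝓔)/(1−δ) ≤ 2(n̄ + β·N̄_w·(12ā/(Rad−1))·(4d̄ + 16ā) + B_𝓔)/(1−δ)`. [folklore] -/
theorem slotConst_le_uniform (Λ : Finset (PBond P j)) (Pw : Finset (Plaq P j)) {a d : PBond P j → ℝ}
    {ā dbar Rad β δ B𝓔 nbar Nw : ℝ} {n : ℕ} (ha0 : ∀ b, 0 ≤ a b) (hd0 : ∀ b, 0 ≤ d b) (hā0 : 0 ≤ ā) (hdb0 : 0 ≤ dbar)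
    (hRad : 1 < Rad) (hβ : 0 ≤ β) (hδ1 : δ < 1) (ha : ∀ b ∈ Λ, a b ≤ ā) (hd : ∀ b ∉ Λ, d b ≤ dbar)
    (hn : (n : ℝ) ≤ nbar) (hNw : (Pw.card : ℝ) ≤ Nw) :
    2 * ((n : ℝ) + (β * ∑ p ∈ Pw, movingSize Λ (fun b => 3 * a b / (Rad - 1)) (plaqOBonds p) *
        (frozenSize Λ d (plaqOBonds p) + 4 * movingSize Λ a (plaqOBonds p)) + B𝓔)) / (1 - δ) ≤
      2 * (nbar + (β * (Nw * (12 * ā / (Rad - 1) * (4 * dbar + 16 * ā))) + B𝓔)) / (1 - δ) := by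
  have h1δ : 0 < 1 - δ := by linarith
  have hR1 : 0 < Rad - 1 := by linarith
  have hL0 : ∀ b, 0 ≤ 3 * a b / (Rad - 1) := fun b => div_nonneg (by linarith [ha0 b]) hR1.le
  -- the per-plaquette bound
  have hterm : ∀ p ∈ Pw, movingSize Λ (fun b => 3 * a b / (Rad - 1)) (plaqOBonds p) *
      (frozenSize Λ d (plaqOBonds p) + 4 * movingSize Λ a (plaqOBonds p)) ≤
        12 * ā / (Rad - 1) * (4 * dbar + 16 * ā) := by
    intro p _
    obtain ⟨hs, hL, hdd⟩ := plaqSizes_le Λ hā0 hdb0 hRad ha hd p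
    have hs0 := (sizes_nonneg Λ ha0 hd0 (plaqOBonds p)).1
    have hd0' := (sizes_nonneg Λ ha0 hd0 (plaqOBonds p)).2
    have hL0' := (sizes_nonneg Λ hL0 hd0 (plaqOBonds p)).1
    exact mul_le_mul hL (by linarith) (by linarith) (div_nonneg (by linarith) hR1.le)
  have hK0 : 0 ≤ 12 * ā / (Rad - 1) * (4 * dbar + 16 * ā) :=
    mul_nonneg (div_nonneg (by linarith) hR1.le) (by linarith)
  have hsum : ∑ p ∈ Pw, movingSize Λ (fun b => 3 * a b / (Rad - 1)) (plaqOBonds p) *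
      (frozenSize Λ d (plaqOBonds p) + 4 * movingSize Λ a (plaqOBonds p)) ≤
        Nw * (12 * ā / (Rad - 1) * (4 * dbar + 16 * ā)) := by
    refine (Finset.sum_le_card_nsmul _ _ _ hterm).trans ?_
    rw [nsmul_eq_mul]
    exact mul_le_mul_of_nonneg_right hNw hK0
  have hnum : (n : ℝ) + (β * ∑ p ∈ Pw, movingSize Λ (fun b => 3 * a b / (Rad - 1)) (plaqOBonds p) *
      (frozenSize Λ d (plaqOBonds p) + 4 * movingSize Λ a (plaqOBonds p)) + B𝓔) ≤
        nbar + (β * (Nw * (12 * ā / (Rad - 1) * (4 * dbar + 16 * ā))) + B𝓔) := by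
    have := mul_le_mul_of_nonneg_left hsum hβ
    linarith
  exact div_le_div_of_nonneg_right (by linarith) h1δ.le

end Cell

/-! ## §3 END-II from block bond data with the LEVEL-ONLY constant -/

section EndTwo

variable {P : Params} {j : ℕ} [DecidableEq (PBond P j)]
variable {A : Type*} [NormedRing A] [NormedAlgebra ℂ A] [CompleteSpace A] [NormOneClass A]

/-- **END-II ⇐ PER-BOND BINDERS, LEVEL-ONLY CONSTANT.**  `slotAC_realized_su2_of_blockBondData` (S4 file 1) followed by
`slotConst_le_uniform` and `T4ShellMeasureFibre.slotAntiConcentration_mono`: under the additional UNIFORM-GEOMETRY binders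
`n ≤ n̄`, `#P_w ≤ N̄_w`, `a_b ≤ ā` (all bonds), `d_b ≤ d̄`, the realized (M1) holds with the constant
`D̄ = 2(n̄ + β·N̄_w·(12ā/(Rad−1))·(4d̄ + 16ā) + B_𝓔)/(1−δ)`, which depends on the LEVEL's displayed numbers only — the
shape END-I's `hac`/`hDA` (`ShellMeasureRootComposition.shellWeightBound_of_slotAC`) and the SEAM (row S13) consume.
CONDITIONAL on every binder; nothing PRINTED is asserted; NE7c NOT proved. [folklore] -/
theorem slotAC_realized_su2_of_blockBondData_uniform {T : Finset (PBond P j)} (hT : NoClosedLoop T)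
    (U₀ : GaugeField P j SU2) (Λ : Finset (PBond P j)) {n : ℕ} (e : ↥Λ × Fin 3 ≃ Fin n)
    {S : ℝ} (hS : 0 < S) (hSπ : 3 * S ^ 2 < Real.pi ^ 2) (c : GaugeField P j SU2 → GaugeField P j SU2)
    {R : GaugeField P j SU2 → (↥Λ → SU2) → ℝ≥0∞} (hR : ∀ V, Measurable (R V))
    {F : GaugeField P j SU2 → ℝ≥0∞} (hF : Measurable F) (hFi : GaugeInvariant F)
    (hFw : ∀ V y, F (fixTo T U₀ (updateFinset V Λ y)) =
      ENNReal.ofReal (expWindowDensity Λ (c V) S (updateFinset (c V) Λ y)) * R V y)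
    (hfin : ∀ V, ((blockLaw Λ).withDensity fun y => F (fixTo T U₀ (updateFinset V Λ y))) univ ≠ ∞)
    {u : GaugeField P j SU2 → ℝ} (hu : Measurable u) (hui : GaugeInvariant u)  -- level data per exterior section:
    (Ttr : TraceData A) (hN : 0 < Ttr.N) {Pu : Finset (Plaq P j)} (hPu : Pu.Nonempty)
    (hol : GaugeField P j SU2 → Plaq P j → (Fin n → ℝ) → A) (hcont : ∀ V, ∀ p ∈ Pu, Continuous (hol V p))
    (Pw : Finset (Plaq P j)) (G : GaugeField P j SU2 → Plaq P j → (Fin n → ℝ) → A) (𝓔 : GaugeField P j SU2 → (Fin n → ℝ) → ℝ)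
    (W : GaugeField P j SU2 → Set (Fin n → ℝ)) (Jco : GaugeField P j SU2 → (Fin n → ℝ) → ℝ≥0∞)
    {θ δ ρ β Rad ā dbar B𝓔 nbar Nw : ℝ}  -- DICTIONARY; SM-L5/L6 kept co-tests (window, centre-monotone):
    (hRdict : ∀ V x, R V (expFibreChart Λ (c V) e x) = Jco V x * weight Ttr β Pw (G V) (𝓔 V) x)
    (hudict : ∀ V x, u (fixTo T U₀ (updateFinset V Λ (expFibreChart Λ (c V) e x))) = classifier hPu (hol V) x)
    (hJW : ∀ V x, Jco V x ≠ 0 → x ∈ W V)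
    (hJ : ∀ V x, ∀ a : ℝ, 0 ≤ a → Jco V x ≤ Jco V (Real.exp (-a) • x))
    -- THE BLOCK BOND DATA (as in file 1) with UNIFORM sizes `a_b ≤ ā` on all bonds, `d_b ≤ d̄`
    (Λu : Finset (PBond P j)) (hcov : ∀ p ∈ Pu, ∀ bo ∈ plaqOBonds p, bo.1 ∈ Λu)
    (X : GaugeField P j SU2 → (Fin n → ℝ) → PBond P j → ℂ → A)
    (ext : GaugeField P j SU2 → PBond P j → Bool → A) (a d : PBond P j → ℝ) (ha0 : ∀ b, 0 ≤ a b)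
    (hd0 : ∀ b, 0 ≤ d b) (hā : ∀ b, a b ≤ ā) (hdbar : ∀ b, d b ≤ dbar) (hdb0 : 0 ≤ dbar) (hRad : 1 < Rad)
    (hXu : ∀ V, ∀ x ∈ W V, ∀ b ∈ Λu, DifferentiableOn ℂ (X V x b) (ball 0 Rad) ∧
      (∀ w ∈ ball (0 : ℂ) Rad, ‖X V x b w‖ ≤ a b) ∧ X V x b 0 = 0)
    (hXw : ∀ V, ∀ x ∈ W V, ∀ b ∈ Λ, DifferentiableOn ℂ (X V x b) (ball 0 Rad) ∧
      (∀ w ∈ ball (0 : ℂ) Rad, ‖X V x b w‖ ≤ a b) ∧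
      ∀ c' : ℝ, 0 ≤ c' → c' ≤ 1 → Ttr.τ (X V x b c') = 0 ∧ ‖exp (X V x b c')‖ ≤ 1 ∧ ‖exp (-(X V x b c'))‖ ≤ 1)
    (hext : ∀ V, ∀ p ∈ Pw, ∀ bo ∈ plaqOBonds p, bo.1 ∉ Λ →
      ‖ext V bo.1 bo.2‖ ≤ 1 ∧ ‖ext V bo.1 bo.2 - 1‖ ≤ d bo.1)
    (hhol : ∀ V, ∀ x ∈ W V, ∀ p ∈ Pu, ∀ c' : ℝ, 0 ≤ c' → c' ≤ 1 →
      hol V p (c' • x) = exp (X V x ⟨p.src, p.μ⟩ c') * exp (X V x ⟨p.src.shift p.μ, p.ν⟩ c') *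
        exp (-(X V x ⟨p.src.shift p.ν, p.μ⟩ c')) * exp (-(X V x ⟨p.src, p.ν⟩ c')))
    (hG : ∀ V, ∀ x ∈ W V, ∀ p ∈ Pw, ∀ c' : ℝ, 0 ≤ c' → c' ≤ 1 →
      G V p (c' • x) = bondFactor Λ (X V x) (ext V) c' (⟨p.src, p.μ⟩, false) *
        bondFactor Λ (X V x) (ext V) c' (⟨p.src.shift p.μ, p.ν⟩, false) *
        bondFactor Λ (X V x) (ext V) c' (⟨p.src.shift p.ν, p.μ⟩, true) *
        bondFactor Λ (X V x) (ext V) c' (⟨p.src, p.ν⟩, true))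
    (hs1 : 4 * ā ≤ 1)  -- uniform smallness (⇒ `s̄_p ≤ 1`); uniform geometry; SM-L4; numbers; SM-L2 with `H = e^{4ā} − 1`:
    (hn : (n : ℝ) ≤ nbar) (hNw : (Pw.card : ℝ) ≤ Nw)
    (hE : ∀ V, ∀ x ∈ W V, ∀ c' : ℝ, 1 / 2 ≤ c' → c' ≤ 1 → 𝓔 V (c' • x) ≤ 𝓔 V x + (1 - c') * B𝓔) (hB𝓔 : 0 ≤ B𝓔)
    (hθ : 0 < θ) (hδ0 : 0 ≤ δ) (hδ1 : δ < 1) (hρ0 : 0 ≤ ρ) (hρ : ρ ≤ (1 - δ) / 2) (hβ : 0 ≤ β)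
    (hSM : 36 * (Real.exp (4 * ā) - 1) * 1 ^ 2 / (Rad - 1) ^ 2 ≤ δ * θ) :
    SlotAntiConcentration ((fieldMeasure P j SU2).withDensity F) u θ ρ
      (2 * (nbar + (β * (Nw * (12 * ā / (Rad - 1) * (4 * dbar + 16 * ā))) + B𝓔)) / (1 - δ)) := by
  have hā0 : 0 ≤ ā := by obtain ⟨p, _⟩ := hPu; exact (ha0 ⟨p.src, p.μ⟩).trans (hā _)
  have h := slotAC_realized_su2_of_blockBondData hT U₀ Λ e hS hSπ c hR hF hFi hFw hfin hu hui Ttr hN hPu hol hcont Pw G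
    𝓔 W Jco hRdict hudict hJW hJ Λu hcov X ext a d ha0 hd0 hRad hXu (fun b _ => hā b) hXw hext hhol hG
    (fun p _ => ((plaqSizes_le Λ hā0 hdb0 hRad (fun b _ => hā b) (fun b _ => hdbar b) p).1).trans hs1)
    hE hB𝓔 hθ hδ0 hδ1 hρ0 hρ hβ hSM
  exact slotAntiConcentration_mono hρ0
    (slotConst_le_uniform Λ Pw ha0 hd0 hā0 hdb0 hRad hβ hδ1 (fun b _ => hā b) (fun b _ => hdbar b) hn hNw) h

end EndTwo

end Summit.QuantumFields.BalabanUV.T4Continuum.ShellMeasureBlockWiring
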